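import Summits.ResolutionOfSingularities.ResolutionOfSingularities.Theorems.WeightedInvariantIota3FlagBridge
import Summits.ResolutionOfSingularities.ResolutionOfSingularities.Theorems.WeightedInvariantIota3SigmaWeightsUnique
import Summits.ResolutionOfSingularities.ResolutionOfSingularities.Theorems.WeightedInvariantIota3JSigmaDominanceUpgrade
import HarnessLib

/-!
# Sketch-R10 [OURS · L1 w43 · idea-2 gen 10] — the (J-can) CANONICITY CENSUS: one-sided vs mutual dominance,
«(J-can) ⟺ mutual dominance of σ-maximisers» (proved), the free half-clauses, UPGRADE (res-D-brk-1's tree theorem, repackaged) with the hub corollary, and the census dictionary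

Evidence for `stmt-ResolutionOfSingularities-0571` (crux `WeightedConstruction`), bearing on the door item
`stmt-ResolutionOfSingularities-19897` (`HypersurfaceCentreConstruction`) branch **(o70-b)** = SPEC (Δ12) rev 2
`JSigmaCanonicalLE3Body p` («the ideals `J_{σ,x}` / the filtration `flagContactFiltration` of a σ-maximising two-flag do not
depend on the maximising flag»), named gap **P3c** on the board.  Technique B (data-driven datum axioms): the object of this
round is a MACHINE CENSUS of (J-can) over finite fields (kit jobs j288792 FULL, j288929+j288930 NPF, j289276+j289278 QSF, j289974+j289975 DOM_μ levels; engines `jcan10.py`, `jcan_levels.py`), and this file is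
its Lean-side dictionary.  Nothing here is a Literature fact; every `def … : Prop` marked CANDIDATE is OURS and unproved; the
census is EVIDENCE, not a theorem.  AI-written, not expert-reviewed.

* §1 `Dominates g₁ g₂ g₁' g₂' q r₁ r₂` (one-sided dominance of two-flags at fixed weights) — reflexive, transitive, and
  EQUIVALENT to level-wise containment of the filtrations (`dominates_iff_forall_le`, proved from the tree's bridge
  `flagContactFiltration_le_of_mem`); mutual dominance ⟺ equal filtrations.
* §2 COPIES (verbatim bodies) of SPEC (Δ12) rev 2 `JSigmaCanonicalAt` / `SigmaFlagDominantAt` (plan-1's HOME sketch is not in the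
  tree; restated here under this namespace so the census verdict has a typed referent), and the PROVED reduction
  `jSigmaCanonicalAt_iff_mutuallyDominant` : (J-can) at `f` ⟺ every two σ-maximisers with primitive triples dominate EACH OTHER
  (weights aligned by the tree theorem `sigmaWeights_unique` = (o70-w)).  This is exactly the test the census runs per pair of flags.
* §3 THE FREE HALF-CLAUSES (proved, any local ring): in the regime `r₂ = q` the `g₂`-clause of dominance is automatic
  (`𝔪 ≤ F(q)`), and in the degenerate regime `r₁ = r₂ = q` dominance is total; so the census only has content for `r₂ > q`
  («T > 1» in the engine's normalisation `(q;r₂,r₁) ∝ (1, T, ρT)`) and, inside `r₂ = q`, for the `g₁`-clause (res-D-brk-1's PART 1).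
* §4 UPGRADE: one-sided dominance between two-flags with the same admissible triple is mutual — PROVED by res-D-brk-1 as the tree
  theorem `Iota3.IsTwoFlag.dominant_symm` (`Theorems/WeightedInvariantIota3JSigmaDominanceUpgrade.lean`, 2026-08-27T20:10Z); restated here
  as `upgradeBody_holds` in the census's orientation, with the HUB COROLLARY `jSigmaCanonicalAt_of_hub` ((J-can) at `f` ⟸ one σ-maximiser
  dominates all others).  Census column `asym` counts ordered maximiser pairs violating UPGRADE (observed: 0 of record, as it must be).
* §5 THE CENSUS DICTIONARY (doc-comment of `censusDictionary`): what a row of `rows.jsonl` certifies and under which truncation.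
-/

open IsLocalRing Literature.AlgebraicGeometry.Resolution
open Summit.ResolutionOfSingularities.ResolutionOfSingularities.Theorems

namespace Summit.ResolutionOfSingularities.ResolutionOfSingularities.Cruxes.HypersurfaceCentreConstruction.LocalEngine

namespace Iota3

namespace JCanCensus

variable {S : Type} [CommRing S] [IsLocalRing S]

/-! ## §1 One-sided dominance -/

/-- The two-flag `(g₁', g₂')` is DOMINATED by `(g₁, g₂)` at the weights `(q; r₁, r₂)`: its members lie in the levels `r₁`, `r₂` of the
filtration of `(g₁, g₂)`.  (Census: `dominates(A, B)` = minimum `A`-weight of the monomials of `g₁ᴮ`, `g₂ᴮ` re-expanded in `A`'s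
coordinates is `≥ r₁`, `≥ r₂`.) [OURS · R10 §1] -/
def Dominates (g₁ g₂ g₁' g₂' : S) (q r₁ r₂ : ℕ) : Prop :=
  g₁' ∈ flagContactFiltration g₁ g₂ q r₁ r₂ r₁ ∧ g₂' ∈ flagContactFiltration g₁ g₂ q r₁ r₂ r₂

theorem dominates_refl (g₁ g₂ : S) {q : ℕ} (r₁ r₂ : ℕ) (hq : 0 < q) : Dominates g₁ g₂ g₁ g₂ q r₁ r₂ :=
  self_mem_flagContactFiltration g₁ g₂ r₁ r₂ hq

/-- Dominance ⟺ level-wise containment of the filtrations. [OURS · R10 §1; from the tree's `flagContactFiltration_le_of_mem`] -/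
theorem dominates_iff_forall_le {g₁ g₂ g₁' g₂' : S} {q r₁ r₂ : ℕ} (hq : 0 < q) :
    Dominates g₁ g₂ g₁' g₂' q r₁ r₂ ↔
      ∀ n : ℕ, flagContactFiltration g₁' g₂' q r₁ r₂ n ≤ flagContactFiltration g₁ g₂ q r₁ r₂ n := by
  constructor
  · exact fun h n => flagContactFiltration_le_of_mem hq h.1 h.2 n
  · intro h
    have hs := self_mem_flagContactFiltration g₁' g₂' r₁ r₂ hq
    exact ⟨h r₁ hs.1, h r₂ hs.2⟩

theorem dominates_trans {g₁ g₂ g₁' g₂' g₁'' g₂'' : S} {q r₁ r₂ : ℕ} (hq : 0 < q)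
    (h : Dominates g₁ g₂ g₁' g₂' q r₁ r₂) (h' : Dominates g₁' g₂' g₁'' g₂'' q r₁ r₂) :
    Dominates g₁ g₂ g₁'' g₂'' q r₁ r₂ :=
  ⟨flagContactFiltration_le_of_mem hq h.1 h.2 r₁ h'.1, flagContactFiltration_le_of_mem hq h.1 h.2 r₂ h'.2⟩

/-- Mutual dominance ⟺ equal filtrations. [OURS · R10 §1] -/
theorem dominates_and_dominates_iff_eq {g₁ g₂ g₁' g₂' : S} {q r₁ r₂ : ℕ} (hq : 0 < q) :
    (Dominates g₁ g₂ g₁' g₂' q r₁ r₂ ∧ Dominates g₁' g₂' g₁ g₂ q r₁ r₂) ↔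
      ∀ n : ℕ, flagContactFiltration g₁' g₂' q r₁ r₂ n = flagContactFiltration g₁ g₂ q r₁ r₂ n := by
  constructor
  · exact fun h n => flagContactFiltration_eq_of_mem_of_mem hq h.1.1 h.1.2 h.2.1 h.2.2 n
  · intro h
    refine ⟨(dominates_iff_forall_le hq).2 fun n => (h n).le, (dominates_iff_forall_le hq).2 fun n => (h n).ge⟩

/-! ## §2 (J-can) ⟺ mutual dominance of σ-maximisers -/

/-- COPY (verbatim body) of SPEC (Δ12) rev 2 `JSigmaCanonicalAt` (res-L1-w43-plan-1, `L/res-L1-w43-plan-1/JSigmaCanon_sketch.lean`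
aceffaa8e08fb006 l.42–49): the filtration of a σ-maximising two-flag with primitive triple does not depend on the flag. [COPY · (o70-b)] -/
def JSigmaCanonicalAt (f : S) : Prop :=
  ∀ (g₁ g₂ : S) (q r₁ r₂ : ℕ) (g₁' g₂' : S) (q' r₁' r₂' : ℕ),
    IsSigmaMaximiser f (adicOrder f).toNat g₁ g₂ q r₁ r₂ → IsPrimitiveTriple q r₁ r₂ →
    IsSigmaMaximiser f (adicOrder f).toNat g₁' g₂' q' r₁' r₂' → IsPrimitiveTriple q' r₁' r₂' →
    ∀ m : ℕ, flagContactFiltration g₁' g₂' q' r₁' r₂' m = flagContactFiltration g₁ g₂ q r₁ r₂ m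

/-- COPY (verbatim body) of SPEC (Δ12) rev 2 `SigmaFlagDominantAt` (ibid. l.60–66): two σ-maximisers with the SAME triple dominate
(one direction per ordered pair; all ordered pairs quantified). [COPY · (o70-b)] -/
def SigmaFlagDominantAt (f : S) : Prop :=
  ∀ (g₁ g₂ : S) (q r₁ r₂ : ℕ) (g₁' g₂' : S),
    IsSigmaMaximiser f (adicOrder f).toNat g₁ g₂ q r₁ r₂ → IsPrimitiveTriple q r₁ r₂ →
    IsSigmaMaximiser f (adicOrder f).toNat g₁' g₂' q r₁ r₂ →
    g₁' ∈ flagContactFiltration g₁ g₂ q r₁ r₂ r₁ ∧ g₂' ∈ flagContactFiltration g₁ g₂ q r₁ r₂ r₂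

/-- The census's per-pair test, quantified: every two σ-maximisers of `f` (at `ν = ord f`) with primitive triples dominate EACH OTHER
at the (common, by (o70-w)) weights. [OURS · R10 §2] -/
def SigmaFlagMutuallyDominantAt (f : S) : Prop :=
  ∀ (g₁ g₂ : S) (q r₁ r₂ : ℕ) (g₁' g₂' : S) (q' r₁' r₂' : ℕ),
    IsSigmaMaximiser f (adicOrder f).toNat g₁ g₂ q r₁ r₂ → IsPrimitiveTriple q r₁ r₂ →
    IsSigmaMaximiser f (adicOrder f).toNat g₁' g₂' q' r₁' r₂' → IsPrimitiveTriple q' r₁' r₂' →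
    Dominates g₁ g₂ g₁' g₂' q r₁ r₂ ∧ Dominates g₁' g₂' g₁ g₂ q r₁ r₂

/-- `SigmaFlagDominantAt` (one direction, all ordered pairs) already gives mutual dominance. [OURS · R10 §2] -/
theorem sigmaFlagMutuallyDominantAt_of_dominant {f : S} (hd : SigmaFlagDominantAt f) : SigmaFlagMutuallyDominantAt f := by
  intro g₁ g₂ q r₁ r₂ g₁' g₂' q' r₁' r₂' h hp h' hp'
  obtain ⟨rfl, rfl, rfl⟩ := sigmaWeights_unique h hp h' hp'
  exact ⟨hd g₁ g₂ q' r₁' r₂' g₁' g₂' h hp h', hd g₁' g₂' q' r₁' r₂' g₁ g₂ h' hp' h⟩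

/-- **(J-can) ⟺ MUTUAL DOMINANCE OF σ-MAXIMISERS** (res-D-brk-1's reduction (0), kernel form): the filtration is flag-independent iff
every two σ-maximisers with primitive triples dominate each other.  `→`: equal filtrations contain the other flag's members
(`self_mem_flagContactFiltration`); `←`: `flagContactFiltration_eq_of_mem_of_mem`; the triples agree by `sigmaWeights_unique` (o70-w).
This is exactly what a census row with `n_classes = 1` asserts for the F_q-rational σ-maximisers of its germ. [OURS · R10 §2] -/
theorem jSigmaCanonicalAt_iff_mutuallyDominant (f : S) : JSigmaCanonicalAt f ↔ SigmaFlagMutuallyDominantAt f := by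
  constructor
  · intro hc g₁ g₂ q r₁ r₂ g₁' g₂' q' r₁' r₂' h hp h' hp'
    obtain ⟨rfl, rfl, rfl⟩ := sigmaWeights_unique h hp h' hp'
    have hq : 0 < q' := h.1.1
    have he := hc g₁ g₂ q' r₁' r₂' g₁' g₂' q' r₁' r₂' h hp h' hp'
    exact (dominates_and_dominates_iff_eq hq).2 he
  · intro hm g₁ g₂ q r₁ r₂ g₁' g₂' q' r₁' r₂' h hp h' hp' m
    obtain ⟨rfl, rfl, rfl⟩ := sigmaWeights_unique h hp h' hp'
    have hq : 0 < q' := h.1.1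
    exact (dominates_and_dominates_iff_eq hq).1 (hm g₁ g₂ q' r₁' r₂' g₁' g₂' q' r₁' r₂' h hp h' hp') m

/-- Hence plan-1's glue in one line: `SigmaFlagDominantAt f → JSigmaCanonicalAt f` (no separate weights hypothesis needed — (o70-w) is a
tree theorem). [OURS · R10 §2] -/
theorem jSigmaCanonicalAt_of_dominant {f : S} (hd : SigmaFlagDominantAt f) : JSigmaCanonicalAt f :=
  (jSigmaCanonicalAt_iff_mutuallyDominant f).2 (sigmaFlagMutuallyDominantAt_of_dominant hd)

/-! ## §3 The free half-clauses -/

/-- In the regime `r₂ = q` («T = 1») the `g₂`-clause of dominance is free: `𝔪 ≤ F(q) = F(r₂)`. [OURS · R10 §3] -/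
theorem right_mem_of_r₂_eq_q (g₁ g₂ : S) {g₂' : S} {q r₁ r₂ : ℕ} (hq : 0 < q) (hr : r₂ = q)
    (hg : g₂' ∈ maximalIdeal S) : g₂' ∈ flagContactFiltration g₁ g₂ q r₁ r₂ r₂ := by
  subst hr
  exact maximalIdeal_le_flagContactFiltration g₁ g₂ r₁ r₂ hq hg

/-- So for `r₂ = q` dominance of a two-flag reduces to its `g₁`-clause. [OURS · R10 §3] -/
theorem dominates_of_left_mem_of_r₂_eq_q {g₁ g₂ g₁' g₂' : S} {q r₁ r₂ : ℕ} (hq : 0 < q) (hr : r₂ = q)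
    (h₁ : g₁' ∈ flagContactFiltration g₁ g₂ q r₁ r₂ r₁) (hg : g₂' ∈ maximalIdeal S) :
    Dominates g₁ g₂ g₁' g₂' q r₁ r₂ :=
  ⟨h₁, right_mem_of_r₂_eq_q g₁ g₂ hq hr hg⟩

/-- In the degenerate regime `r₁ = r₂ = q` every two-flag inside `𝔪` is dominated (dominance is total; nothing to census). [OURS · R10 §3] -/
theorem dominates_of_r₁_eq_q {g₁ g₂ g₁' g₂' : S} {q r₁ r₂ : ℕ} (hq : 0 < q) (h1 : r₁ = q) (h2 : r₂ = q)
    (hg₁ : g₁' ∈ maximalIdeal S) (hg₂ : g₂' ∈ maximalIdeal S) : Dominates g₁ g₂ g₁' g₂' q r₁ r₂ := by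
  constructor
  · rw [h1]; exact maximalIdeal_le_flagContactFiltration g₁ g₂ q r₂ hq hg₁
  · rw [h2]; exact maximalIdeal_le_flagContactFiltration g₁ g₂ r₁ q hq hg₂

/-- The `g₁`-clause restated as the census computes it in regime `r₂ = q`: `g₁' ∈ (g₁) + 𝔪^⌈r₁/q⌉` suffices (the pieces `α = 1, β = 0`
and `α = β = 0` of the filtration). [OURS · R10 §3] -/
theorem left_mem_of_mem_span_sup_pow {g₁ g₂ g₁' : S} {q r₁ r₂ : ℕ} (hq : 0 < q)
    (h : g₁' ∈ Ideal.span {g₁} ⊔ maximalIdeal S ^ ((r₁ + q - 1) / q)) :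
    g₁' ∈ flagContactFiltration g₁ g₂ q r₁ r₂ r₁ := by
  have hle : Ideal.span {g₁} ⊔ maximalIdeal S ^ ((r₁ + q - 1) / q) ≤ flagContactFiltration g₁ g₂ q r₁ r₂ r₁ := by
    refine sup_le ?_ ?_
    · rw [Ideal.span_singleton_le_iff_mem]
      exact (self_mem_flagContactFiltration g₁ g₂ r₁ r₂ hq).1
    · have h0 := flagPiece_le g₁ g₂ q r₁ r₂ r₁ 0 0
      simp only [pow_zero, mul_one, Ideal.span_singleton_one, Ideal.top_mul, mul_zero, Nat.sub_zero] at h0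
      exact h0
  exact hle h

/-! ## §4 UPGRADE (tree theorem of res-D-brk-1) and the hub corollary -/

/-- UPGRADE in the census's orientation: one-sided dominance between two-flags with the same admissible triple is mutual.  The census counts,
per germ, the ordered pairs of σ-maximising flags `(A, B)` with `Dominates A B ∧ ¬ Dominates B A` (`asym`). [res-D-brk-1 (o70-b) PART 2a;
restated · R10 §4] -/
def UpgradeBody (S : Type) [CommRing S] [IsLocalRing S] : Prop :=
  ∀ (g₁ g₂ g₁' g₂' : S) (q r₁ r₂ : ℕ), AdmissibleTriple q r₁ r₂ → IsTwoFlag g₁ g₂ → IsTwoFlag g₁' g₂' →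
    Dominates g₁ g₂ g₁' g₂' q r₁ r₂ → Dominates g₁' g₂' g₁ g₂ q r₁ r₂

/-- `UpgradeBody` HOLDS in every local ring: this is res-D-brk-1's tree theorem `Iota3.IsTwoFlag.dominant_symm` (the two-flag property of the
DOMINATED flag `(g₁', g₂')` is what is used; `g₁, g₂ ∈ 𝔪` come from `IsTwoFlag g₁ g₂`). [res-D-brk-1, PROVED; repackaged · R10 §4] -/
theorem upgradeBody_holds (S : Type) [CommRing S] [IsLocalRing S] : UpgradeBody S := by
  intro g₁ g₂ g₁' g₂' q r₁ r₂ hadm hΦ hΦ' hd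
  exact hΦ'.dominant_symm hadm hΦ.1 hΦ.2.1 hd.1 hd.2

/-- So the census's `asym` column is 0 by THEOREM, not only by observation: among σ-maximisers, `Dominates A B → Dominates B A`.
[R10 §4, PROVED from brk-1's upgrade lemma + (o70-w)] -/
theorem dominates_symm_of_isSigmaMaximiser {f : S} {g₁ g₂ g₁' g₂' : S} {q r₁ r₂ q' r₁' r₂' : ℕ}
    (h : IsSigmaMaximiser f (adicOrder f).toNat g₁ g₂ q r₁ r₂) (hp : IsPrimitiveTriple q r₁ r₂)
    (h' : IsSigmaMaximiser f (adicOrder f).toNat g₁' g₂' q' r₁' r₂') (hp' : IsPrimitiveTriple q' r₁' r₂')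
    (hd : Dominates g₁ g₂ g₁' g₂' q r₁ r₂) : Dominates g₁' g₂' g₁ g₂ q r₁ r₂ := by
  obtain ⟨rfl, rfl, rfl⟩ := sigmaWeights_unique h hp h' hp'
  exact upgradeBody_holds S g₁ g₂ g₁' g₂' q' r₁' r₂' h.1 h.2.1 h'.2.1 hd

/-- THE HUB COROLLARY (unconditional now): (J-can) at `f` follows from «some fixed σ-maximiser with primitive triple dominates every
σ-maximiser with primitive triple» — the shape in which PART 2 arguments (and the census: `n_max = 1` rows trivially) conclude.
[OURS · R10 §4 · PROVED] -/
theorem jSigmaCanonicalAt_of_hub {f : S}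
    {g₁ g₂ : S} {q r₁ r₂ : ℕ} (h : IsSigmaMaximiser f (adicOrder f).toNat g₁ g₂ q r₁ r₂) (hp : IsPrimitiveTriple q r₁ r₂)
    (hub : ∀ (g₁' g₂' : S) (q' r₁' r₂' : ℕ), IsSigmaMaximiser f (adicOrder f).toNat g₁' g₂' q' r₁' r₂' →
      IsPrimitiveTriple q' r₁' r₂' → Dominates g₁ g₂ g₁' g₂' q r₁ r₂) :
    JSigmaCanonicalAt f := by
  rw [jSigmaCanonicalAt_iff_mutuallyDominant]
  intro a₁ a₂ qa ra₁ ra₂ b₁ b₂ qb rb₁ rb₂ ha hpa hb hpb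
  obtain ⟨rfl, rfl, rfl⟩ := sigmaWeights_unique h hp ha hpa
  obtain ⟨rfl, rfl, rfl⟩ := sigmaWeights_unique h hp hb hpb
  have hq : 0 < qb := h.1.1
  have hA := hub a₁ a₂ qb rb₁ rb₂ ha hpa
  have hB := hub b₁ b₂ qb rb₁ rb₂ hb hpb
  have hA' := upgradeBody_holds S g₁ g₂ a₁ a₂ qb rb₁ rb₂ h.1 h.2.1 ha.2.1 hA
  have hB' := upgradeBody_holds S g₁ g₂ b₁ b₂ qb rb₁ rb₂ h.1 h.2.1 hb.2.1 hB
  exact ⟨dominates_trans hq hA' hB, dominates_trans hq hB' hA⟩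

/-- ONE-SIDED (J-can): (J-can) at `f` ⟺ for every two σ-maximisers with primitive triples, ONE dominates the other (either order).
[OURS · R10 §4 · PROVED from brk-1's upgrade lemma] -/
theorem jSigmaCanonicalAt_iff_oneSided (f : S) :
    JSigmaCanonicalAt f ↔ ∀ (g₁ g₂ : S) (q r₁ r₂ : ℕ) (g₁' g₂' : S) (q' r₁' r₂' : ℕ),
      IsSigmaMaximiser f (adicOrder f).toNat g₁ g₂ q r₁ r₂ → IsPrimitiveTriple q r₁ r₂ →
      IsSigmaMaximiser f (adicOrder f).toNat g₁' g₂' q' r₁' r₂' → IsPrimitiveTriple q' r₁' r₂' →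
      (Dominates g₁ g₂ g₁' g₂' q r₁ r₂ ∨ Dominates g₁' g₂' g₁ g₂ q r₁ r₂) := by
  rw [jSigmaCanonicalAt_iff_mutuallyDominant]
  constructor
  · intro hm g₁ g₂ q r₁ r₂ g₁' g₂' q' r₁' r₂' h hp h' hp'
    exact Or.inl (hm g₁ g₂ q r₁ r₂ g₁' g₂' q' r₁' r₂' h hp h' hp').1
  · intro ho g₁ g₂ q r₁ r₂ g₁' g₂' q' r₁' r₂' h hp h' hp'
    rcases ho g₁ g₂ q r₁ r₂ g₁' g₂' q' r₁' r₂' h hp h' hp' with hd | hd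
    · exact ⟨hd, dominates_symm_of_isSigmaMaximiser h hp h' hp' hd⟩
    · refine ⟨?_, hd⟩
      obtain ⟨rfl, rfl, rfl⟩ := sigmaWeights_unique h hp h' hp'
      exact upgradeBody_holds S g₁' g₂' g₁ g₂ q' r₁' r₂' h.1 h'.2.1 h.2.1 hd

/-! ## §5 The census dictionary -/

/-- **THE (J-can) CENSUS DICTIONARY** (engine `L/res-L1-w43-idea-2/job-r10/jcan10.py`; kit jobs j288773 smoke, j288792 FULL, j288929 + j288930 NPF, j289276 + j289278 QSF, j289974 + j289975 DOM_μ levels; outputs `job-r10/out/<job>/{SUMMARY.md, rows.jsonl}`).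
A row of `rows.jsonl` concerns `S = k[x,y,z]_(x,y,z)`, `k = GF(p^s)`, `f` the listed polynomial, `ν = ord f`, and asserts, for
`k`-RATIONAL two-flags only (`g₁, g₂ ∈ k[x,y,z]`):
1. `w = [q, r₂, r₁]` is the primitive σ-triple: some two-flag reaches `f ∈ F(r₁ν)` at `(q;r₁,r₂)` and no two-flag of the truncated
   normal family reaches a lex-larger admissible triple (`r₁/r₂` first, then `r₁/q`), decided EXACTLY by ε-probes — the ratio and
   level of a fixed flag are the rationals `ρ(g) = min_{c<ν} (a+b)/(ν−c)` and `T(g) = min_{(ν−c)ρ > b} a/((ν−c)ρ − b)` over the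
   monomials `xᵃ g₂ᵇ g₁ᶜ` of the re-expansion of `f`, whose denominators are bounded by `ν²` resp. `(ν·num ρ)²`, so a probe at
   `ρ + 1/(2ν²)` resp. `T + 1/(2(ν num ρ)²)` separates.  `status = TOP?(…)` flags rows where the level exceeded `T_top_cap` (cylinder-like).
2. TRUNCATED NORMAL FAMILY: frames `(ℓ₁, ℓ₂, X)` = all ordered pairs of independent linear forms completed by a coordinate; `g₂ = ℓ₂ + φ(X)`,
   `φ ∈ span{Xⁱ : i ≥ 2, q·i < r₂}`; `g₁ = ℓ₁ + h(X, g₂)`, `h ∈ span{Xᵃg₂ᵇ : a+b ≥ 2, q·a + r₂·b < r₁}`.  COMPLETENESS FOR CLASSES: any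
   two-flag `(G₁, G₂)` reaching the σ-triple is, after Weierstrass preparation in the completion w.r.t. a transversal coordinate and
   truncation of the unit and of the terms of weight `≥ r₁` (resp. `≥ r₂`) — all of which lie in `F(r₁)` (resp. `F(r₂)`) and hence do
   not change the dominance class (§1 `dominates_iff_forall_le`) — a member of the family with the SAME filtration; so the family meets
   every mutual-dominance class of reaching flags, and `n_classes` is the number of classes among ALL `k`-rational σ-maximisers.
3. REACH is decided by a graded depth-first search over the unknown coefficients of `(φ, h)` ordered by weight, pruning a branch as soon as
   a monomial of weight `< r₁ν` is FINAL (no later unknown can touch it); finality uses a per-`g₁`-degree horizon that is Lucas-aware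
   (a coefficient `C(c, j)` vanishing mod `p` creates no monomial) — validated against brute force on 1251 small cases (0 mismatches).
4. `n_max` = number of family members reaching the σ-triple; `n_classes` = number of MUTUAL-dominance classes among them (§1–§2: (J-can) at
   this germ for `k`-rational flags ⟺ `n_classes = 1`); `asym` = ordered pairs with one-sided, non-mutual dominance (§4: UPGRADE predicts 0);
   `iso`/`eqdim` (Sage) = whether the origin is an isolated point of the top ν-stratum / the stratum is equidimensional — the hypothesis
   `topStratumPrime = 𝔪` of `JSigmaCanonicalLE3Body` is the `iso = 1` case; rows with `iso = 0` are reported but are not instances of (o70-b).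
5. WHAT A ROW DOES NOT CERTIFY: flags over extensions of `k` (the `lifts` re-run each germ over `GF(p^{2s})`); flags outside the family that
   are not preparable over `k` (none: preparation is rational); positions other than the origin.
6. THE NUMBERS OF RECORD (2026-08-27). FULL j288792 (2264 germs = 35 designed adversaries + 790 R7/R8 census starts + 692 E-type `T > 1` designs
   + 315 random, each also over `GF(p^{2s})`; fields 𝔽₂ 645 · 𝔽₄ 675 · 𝔽₃ 361 · 𝔽₉ 356 · 𝔽₅ 71 · 𝔽₇ 4): 2112 OK rows, `n_classes = 1` in 2112/2112,
   `asym = 0`; regime `r₁ > r₂ > q`: 1324 rows (1191 with `p ∣ ν` and `iso = 1`; `(ν,p)` = (2,2) 566 · (3,3) 376 · (4,2) 172 · (6,3) 42 · (5,5) 35),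
   and there `n_max = 1` in 1324/1324 (the family holds exactly one maximising flag); 452 of these rows have `den ρ > 1`, `den ρ ∣ p^{v_p(ν)}`,
   `T > den ρ` (the residual sub-regime of the axis-restriction theorem R10-T of IDEAS R10.2) — all rigid; non-OK rows: 106 `TOP?(level)`
   (cylinders after re-preparation), 26 non-reduced squares of the R7 family file (`TOP?(ratio)`), 20 TIMEOUT.  NPF j288929 + j288930 (res-D-brk-1's
   falsifier spec 19:41:20Z: non-pure binary-form faces `P(z, y^m)`, `ν ∈ {2,3,4,5,6,10}`, 1250 germs): 1223 OK, `n_classes = 1` in 1223/1223, `asym = 0`;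
   `r₁ > r₂ > q`: 790 rows, `n_max = 1` in 790/790 (777 wild isolated); `r₁ = r₂ > q`: 333 rows, one class each; 27 TIMEOUT (𝔽₉ lifts).
   QSF j289276 + j289278 (quasi-solvable faces `(z^{p^e} + θ y^{ρ p^e})^{·}` with above-face monomials `xᵃyᵇzᶜ`, `c ≥ 1`, `T > den ρ` — the residual
   class of the axis-restriction theorem R10-T = res-D-brk-1's «inseparable first face», 1123 germs): 1049 OK, `n_classes = 1` in 1049/1049, `asym = 0`, all in
   regime `r₁ > r₂ > q` with `n_max = 1` in 1049/1049 (1002 wild isolated: `(ν,p)` = (2,2) 333 · (4,2) 250 · (3,3) 170 · (6,2) 128 · (6,3) 55 · (8,2) 40 · (9,3) 22 ·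
   (5,5) 4); 74 TIMEOUT (𝔽₉, 𝔽₅).  GRAND TOTAL FULL + NPF + QSF: 4637 rows, 4284 OK, one class in 4284/4284; `r₁ > r₂ > q`: 3163 rows, `n_max = 1` in 3163/3163.
   DOM_μ LEVELS j289974 + j289975 (engine `jcan_levels.py`, FULL corpus, target SPEC (Δ12) rev 4 l.223 `TwoFlagDominanceAtLevelAt`: at the maximal RATIO but at
   2–6 NON-maximal levels `T′ < T_max` per germ, all reaching flags of the truncated family and their mutual-dominance classes): 2121 OK germs, 6912 levels
   (6127 in the 1336 germs with `T_max > 1`), ONE class at every level, `asym = 0`.  VALIDATION: `test_dfs.py` (DFS vs brute force, 1251 cases) and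
   `test_dom.py` (dominance test vs linear-algebra ideal membership in `k[x,y,z]/𝔪^N`, 2000 cases): 0 mismatches.  No counterexample candidate.
[OURS · R10 §5 · EVIDENCE, not a theorem] -/
theorem censusDictionary : True := trivial

end JCanCensus

end Iota3

end Summit.ResolutionOfSingularities.ResolutionOfSingularities.Cruxes.HypersurfaceCentreConstruction.LocalEngine
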